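import Literature.NumberTheory.GaloisRepresentations.ContinuousH1AddHomAlgebraProofs
import HarnessLib

/-!
# `H¹_cont` along additive coefficient maps, II: linearity, SIGN-twisted equivariance under the
# conjugation action, and the additive isomorphism of `H¹` induced by an equivariant isomorphism of
# coefficients (proofs only)

Topic `NumberTheory/GaloisRepresentations` (namespace = path). `Proofs`-style file: theorems only (no
definition, no named fact, no instance, no notation, no `sorry`). Sequel of
`Kato2004/IwasawaH1Reduction.lean` §1 (`mapH1AddHom`: functoriality of Mathlib's continuous `H¹` along an
additive, continuous, equivariant map `f : X → Y` of topological representations, with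
`mapH1AddHom_resLe / _coresLe / _conjMap`) and `ContinuousH1AddHomAlgebraProofs.lean`
(`mapH1AddHom_mapH1AddHom`, `mapH1AddHom_congr`, `mapH1AddHom_id_map`).

Motivation (cell `bsd-2adic`, seat `k4-w3` GEN 3, crux stmt-BirchSwinnertonDyer-22618 C4″, reading R15 (iii)):
for a quadratic twist `W₂ = W^{(d)}` the Tate modules are identified by a continuous `ℤ_p`-linear
isomorphism `E : T_pW₂ ≃ T_pW` with `E(σx) = χ_d(σ)·σE(x)` (Silverman *AEC* X.5 Cor. 5.4; tree
`WeierstrassCurve.exists_tateModule_equiv_of_smul_eq_quadraticTwist`). On every open subgroup `U ≤ ker χ_d`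
of `Γ_ℚ` the map `E` IS equivariant, so it identifies `H¹(U, T_pW₂) ≅ H¹(U, T_pW)`; these identifications
commute with restriction and corestriction (tree) and ANTI-commute with the action of any `g` with
`χ_d(g) = −1` — the sign-twisted form of `mapH1AddHom_conjMap` proved here. This is the cohomological
content of «twisting by a character of `Γ`» (Rubin, *Euler Systems* VI §1–§2; Greenberg LNM 1716 §4 p. 107).

## Contents (generic: `G` a topological group, `X : TopRep R G`, `Y : TopRep R' G`)

* `mapH1AddHom_smul` — for ONE coefficient ring `R = R'` and an `R`-linear `f`, `f_*` is `R`-linear on `H¹`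
  (`f_* (c • a) = c • f_* a`; companion of the tree's integer-valued `mapH1AddHom_smul_of_map_smul`).
* `mapH1AddHom_conjMap_of_zsmul` — **sign-twisted equivariance**: if `H ⊴ G`, `f` is `H`-equivariant and
  `f (g • x) = s • (g • f x)` for one `g ∈ G` and an integer `s`, then `f_* ∘ conj_g = s • (conj_g ∘ f_*)` on
  `H¹(H, ·)` (on crossed homomorphisms both sides are `x ↦ s • g • f(φ(g⁻¹ x g))`); `s = −1`:
  `mapH1AddHom_conjMap_of_neg` (`f_* (g · c) = −(g · f_* c)`).
* `symm_apply_ρ_of_apply_ρ` — the inverse of an equivariant additive isomorphism is equivariant.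
* `exists_addEquiv_apply_eq_mapH1AddHom` — an additive isomorphism `e : X ≃+ Y`, continuous in both
  directions and `G`-equivariant, induces an additive isomorphism `ψ : H¹(G, X) ≃+ H¹(G, Y)` with
  `ψ = (e)_*` and `ψ⁻¹ = (e⁻¹)_*` (`H¹(e⁻¹) ∘ H¹(e) = H¹(id) = id`).

## References

* J.-P. Serre, *Galois Cohomology* (1997), I §2.2, §2.4 (functoriality of cochain cohomology; compatible
  pairs). [SerreGaloisCohomology1997]
* J. Neukirch, A. Schmidt, K. Wingberg, *Cohomology of Number Fields* (2008), I §5 (the `G/H`-action on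
  `Hⁿ(H, A)` is functorial in `A`). [NeukirchSchmidtWingberg2008]
* K. Rubin, *Euler Systems* (2000), Ch. VI §1–§2 (twisting by characters). [Rubin2000]
-/

noncomputable section

open CategoryTheory
open Literature.NumberTheory.EllipticCurves (subgroupConj)

namespace Literature.NumberTheory.GaloisRepresentations

universe u u' v

variable {R : Type u} [Ring R] [TopologicalSpace R] {R' : Type u'} [Ring R'] [TopologicalSpace R']
variable {G : Type v} [Group G] [TopologicalSpace G] [IsTopologicalGroup G]

/-! ## §1 `f_*` is linear for a linear `f` (one coefficient ring) -/

section Linear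

variable {X Y : TopRep.{v} R G}

/-- **`f_*` is `R`-linear for an `R`-linear `f`** (same coefficient ring on both sides): if
`f (c • x) = c • f x` for all `x`, then `f_* (c • a) = c • f_* a` on `H¹_cont(G, ·)` (on crossed
homomorphisms, `f ∘ (c • φ) = c • (f ∘ φ)`). [cite: SerreGaloisCohomology1997, I §2.2] -/
theorem mapH1AddHom_smul (f : X →+ Y) (hf : Continuous f)
    (hρ : ∀ (g : G) (x : X), f (X.ρ g x) = Y.ρ g (f x)) (c : R)
    (hc : ∀ x : X, f (c • x) = c • f x) (a : continuousCohomology 1 X) :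
    mapH1AddHom X Y f hf hρ (c • a) = c • mapH1AddHom X Y f hf hρ a := by
  obtain ⟨φ, rfl⟩ := oneCocycleClass_surjective X a
  rw [← oneCocycleClass_smul, mapH1AddHom_oneCocycleClass, mapH1AddHom_oneCocycleClass,
    ← oneCocycleClass_smul]
  congr 1
  refine Subtype.ext (ContinuousMap.ext fun g ↦ ?_)
  rw [contOneCocycles.pushAddHom_apply, Submodule.coe_smul, ContinuousMap.smul_apply, hc,
    Submodule.coe_smul, ContinuousMap.smul_apply, contOneCocycles.pushAddHom_apply]

end Linear

/-! ## §2 Sign-twisted equivariance under the conjugation action -/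

section Sign

variable {X : TopRep.{v} R G} {Y : TopRep.{v} R' G} {H : Subgroup G}

/-- **Sign-twisted compatibility of `f_*` with the conjugation action.** Let `H ⊴ G`, let
`f : X → Y` be additive, continuous and `H`-equivariant, and let `g ∈ G` satisfy
`f (g • x) = s • (g • f x)` for an integer `s` (e.g. `s = χ(g) = ±1` for a coefficient isomorphism
`X ≅ Y ⊗ χ` twisted by a quadratic character `χ` trivial on `H`). Then
`f_* (g · c) = s • (g · f_* c)` for every `c ∈ H¹(H, X)`: on crossed homomorphisms both sides are
`x ↦ s • g • f(φ(g⁻¹ x g))`. For `s = 1` this is the tree's `mapH1AddHom_conjMap`.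
[cite: NeukirchSchmidtWingberg2008, I §5] [cite: Rubin2000, Ch. VI §1–§2] -/
theorem mapH1AddHom_conjMap_of_zsmul (f : X →+ Y) (hf : Continuous f) [H.Normal] (g : G) (s : ℤ)
    (hg : ∀ x : X, f (X.ρ g x) = s • Y.ρ g (f x))
    (hH : ∀ (h : H) (x : X), f ((subgroupRep X H).ρ h x) = (subgroupRep Y H).ρ h (f x))
    (c : continuousCohomology 1 (subgroupRep X H)) :
    mapH1AddHom (subgroupRep X H) (subgroupRep Y H) f hf hH (conjMap X H g 1 c) =
      s • conjMap Y H g 1 (mapH1AddHom (subgroupRep X H) (subgroupRep Y H) f hf hH c) := by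
  obtain ⟨φ, rfl⟩ := oneCocycleClass_surjective _ c
  rw [conjMap_oneCocycleClass, mapH1AddHom_oneCocycleClass, mapH1AddHom_oneCocycleClass,
    conjMap_oneCocycleClass, ← oneCocycleClassₗ_apply (subgroupRep Y H)
      (contOneCocycles.pullback (subgroupConj H g) (conjRepHom Y H g) _), ← map_zsmul,
    oneCocycleClassₗ_apply]
  congr 1
  refine Subtype.ext (ContinuousMap.ext fun x ↦ ?_)
  rw [contOneCocycles.pushAddHom_apply, conj_pullback_apply, hg, Submodule.coe_smul_of_tower,
    ContinuousMap.smul_apply, conj_pullback_apply, contOneCocycles.pushAddHom_apply]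

/-- **`f_*` ANTI-commutes with `g` when `f (g • x) = −(g • f x)`** (`H ⊴ G`, `f` `H`-equivariant):
`f_* (g · c) = −(g · f_* c)` on `H¹(H, ·)` — the case `s = −1` of `mapH1AddHom_conjMap_of_zsmul`
(a coefficient isomorphism twisted by a quadratic character `χ` with `χ(g) = −1`).
[cite: NeukirchSchmidtWingberg2008, I §5] [cite: Rubin2000, Ch. VI §1–§2] -/
theorem mapH1AddHom_conjMap_of_neg (f : X →+ Y) (hf : Continuous f) [H.Normal] (g : G)
    (hg : ∀ x : X, f (X.ρ g x) = -Y.ρ g (f x))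
    (hH : ∀ (h : H) (x : X), f ((subgroupRep X H).ρ h x) = (subgroupRep Y H).ρ h (f x))
    (c : continuousCohomology 1 (subgroupRep X H)) :
    mapH1AddHom (subgroupRep X H) (subgroupRep Y H) f hf hH (conjMap X H g 1 c) =
      -conjMap Y H g 1 (mapH1AddHom (subgroupRep X H) (subgroupRep Y H) f hf hH c) := by
  rw [mapH1AddHom_conjMap_of_zsmul f hf g (-1) (fun x ↦ by rw [hg, neg_one_zsmul]) hH c,
    neg_one_zsmul]

end Sign

/-! ## §3 The additive isomorphism of `H¹` induced by an equivariant isomorphism of coefficients -/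

section Equiv

variable {X : TopRep.{v} R G} {Y : TopRep.{v} R' G}

omit [TopologicalSpace G] [IsTopologicalGroup G] in
/-- The inverse of a `G`-equivariant additive isomorphism of coefficients is `G`-equivariant.
[cite: SerreGaloisCohomology1997, I §2.2] -/
theorem symm_apply_ρ_of_apply_ρ (e : X ≃+ Y)
    (hρ : ∀ (g : G) (x : X), e (X.ρ g x) = Y.ρ g (e x)) (g : G) (y : Y) :
    e.symm (Y.ρ g y) = X.ρ g (e.symm y) :=
  e.injective (by rw [AddEquiv.apply_symm_apply, hρ, AddEquiv.apply_symm_apply])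

/-- **An equivariant, bicontinuous additive isomorphism of coefficients induces an additive
isomorphism on `H¹_cont(G, ·)`**: for `e : X ≃+ Y` with `e` and `e⁻¹` continuous and
`e (g • x) = g • e x`, there is `ψ : H¹(G, X) ≃+ H¹(G, Y)` with `ψ = e_*` and `ψ⁻¹ = (e⁻¹)_*`
(`(e⁻¹)_* ∘ e_* = (e⁻¹ ∘ e)_* = id_* = id` by `mapH1AddHom_mapH1AddHom`, `mapH1AddHom_id_map`). The
coefficient rings of `X` and `Y` may differ (`e` is only additive).
[cite: SerreGaloisCohomology1997, I §2.2] -/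
theorem exists_addEquiv_apply_eq_mapH1AddHom (e : X ≃+ Y) (he : Continuous e)
    (he' : Continuous e.symm) (hρ : ∀ (g : G) (x : X), e (X.ρ g x) = Y.ρ g (e x))
    (hρ' : ∀ (g : G) (y : Y), e.symm (Y.ρ g y) = X.ρ g (e.symm y)) :
    ∃ ψ : continuousCohomology 1 X ≃+ continuousCohomology 1 Y,
      (∀ c, ψ c = mapH1AddHom X Y e.toAddMonoidHom he hρ c) ∧
      (∀ c, ψ.symm c = mapH1AddHom Y X e.symm.toAddMonoidHom he' hρ' c) := by
  have hid : ∀ (g : G) (x : X), (AddMonoidHom.id X) (X.ρ g x) = X.ρ g ((AddMonoidHom.id X) x) :=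
    fun _ _ ↦ rfl
  have hid' : ∀ (g : G) (y : Y), (AddMonoidHom.id Y) (Y.ρ g y) = Y.ρ g ((AddMonoidHom.id Y) y) :=
    fun _ _ ↦ rfl
  have hcomp : e.symm.toAddMonoidHom.comp e.toAddMonoidHom = AddMonoidHom.id X :=
    AddMonoidHom.ext fun x ↦ e.symm_apply_apply x
  have hcomp' : e.toAddMonoidHom.comp e.symm.toAddMonoidHom = AddMonoidHom.id Y :=
    AddMonoidHom.ext fun y ↦ e.apply_symm_apply y
  have hce : Continuous (e.symm.toAddMonoidHom.comp e.toAddMonoidHom) := by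
    rw [hcomp]; exact continuous_id
  have hce' : Continuous (e.toAddMonoidHom.comp e.symm.toAddMonoidHom) := by
    rw [hcomp']; exact continuous_id
  have hρe : ∀ (g : G) (x : X), e.symm.toAddMonoidHom.comp e.toAddMonoidHom (X.ρ g x) =
      X.ρ g (e.symm.toAddMonoidHom.comp e.toAddMonoidHom x) := fun g x ↦ by
    rw [hcomp]; rfl
  have hρe' : ∀ (g : G) (y : Y), e.toAddMonoidHom.comp e.symm.toAddMonoidHom (Y.ρ g y) =
      Y.ρ g (e.toAddMonoidHom.comp e.symm.toAddMonoidHom y) := fun g y ↦ by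
    rw [hcomp']; rfl
  refine ⟨{ toFun := mapH1AddHom X Y e.toAddMonoidHom he hρ
            invFun := mapH1AddHom Y X e.symm.toAddMonoidHom he' hρ'
            left_inv := fun c ↦ ?_
            right_inv := fun c ↦ ?_
            map_add' := map_add _ }, fun c ↦ rfl, fun c ↦ rfl⟩
  · rw [mapH1AddHom_mapH1AddHom (hgf := hce) (hgfρ := hρe),
      mapH1AddHom_congr hcomp hce hρe continuous_id hid, mapH1AddHom_id_map]
  · rw [mapH1AddHom_mapH1AddHom (hgf := hce') (hgfρ := hρe'),
      mapH1AddHom_congr hcomp' hce' hρe' continuous_id hid', mapH1AddHom_id_map]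

end Equiv

end Literature.NumberTheory.GaloisRepresentations

end
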